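import Summits.Ventures.HSemireg.WedgeHankelFrameChange
import Summits.Ventures.HSemireg.WedgeHankelPureKernel

/-!
# Venture HSemireg — BRIDGE: gen 15's frame change `Φs λ` (via gen 6's `mapEquiv`) IS gen 13's shear automorphism `Ψ (shearEquiv λ)` (via
# `CliffordAlgebra.equivOfIsometry`) — one automorphism, two constructions; so E5's `Kr_Φs` and C6's `map_Ψ_Kr` are the same transport

HONEST FRAMING. Part of the Lean index of the computation cell `pub-hsemireg` (seat p10 gen 15, Sunday typer «UNIFORM-IN-n»).  Finite-dimensional EXTERIOR
ALGEBRA over a field ONLY; nothing here says that HC / HC_CM / HC_AV holds; no Literature fact is declared or used.  No new mathematics: an identification.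

THIS FILE (namespace `Summit.Ventures.HSemireg.Wedge.HankelFrameChange` continued; imports E5 `WedgeHankelFrameChange` (734) and C6 `WedgeHankelPureKernel` (732)):
`shear_eq_shearEquiv` (the two linear shears of the generators agree), **`Φs_eq_Ψ`: `Φs λ = Ψ (shearEquiv λ)` as algebra automorphisms** (both are determined by
their action on `ι`), hence `Φs_apply_eq` and the restatement of C6's pure-class result in E5's vocabulary (`uvec_eq_Φs_X`: `u_a = Φs λ (x_a)`).  Class side only.
-/

open Module

namespace Summit.Ventures.HSemireg.Wedge.HankelFrameChange

open Summit.Ventures.HSemireg.Wedge Summit.Ventures.HSemireg.Wedge.Hankel Summit.Ventures.HSemireg.Wedge.BasisFree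
  Summit.Ventures.HSemireg.Wedge.HankelPureKernel

variable (K : Type*) [Field K] {n : ℕ}

/-- th-7's `xI a h` is `Fin.castAdd n ⟨a, h⟩`. -/
lemma xI_eq_castAdd {a : ℕ} (h : a < n) : (Hankel.xI a h : In n) = Fin.castAdd n ⟨a, h⟩ := Fin.ext rfl

/-- th-7's `yI a h` is `Fin.natAdd n ⟨a, h⟩`. -/
lemma yI_eq_natAdd {a : ℕ} (h : a < n) : (Hankel.yI a h : In n) = Fin.natAdd n ⟨a, h⟩ := Fin.ext rfl

/-- **the two shears of the generators coincide**: gen 15's `shear λ` (explicit coordinates) `=` gen 13's `shearEquiv λ` (`id + λ·nilp`), on every vector. -/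
theorem shear_eq_shearEquiv (lam : K) (v : In n → K) : shear K (n := n) lam v = shearEquiv K n lam v := by
  have h : (shear K (n := n) lam).toLinearMap = (shearEquiv K n lam).toLinearMap := by
    refine (b K (In n)).ext fun i => ?_
    rw [LinearEquiv.coe_coe, LinearEquiv.coe_coe, shearEquiv_apply]
    rcases lt_or_ge (i : ℕ) n with hi | hi
    · have e : i = Fin.castAdd n ⟨i, hi⟩ := Fin.ext rfl
      rw [e, shear_b_castAdd, ← xI_eq_castAdd, nilp_b_xI, yI_eq_natAdd]
    · have e : i = Fin.natAdd n ⟨i - n, by have := i.2; omega⟩ := Fin.ext (by simp [Fin.natAdd]; omega)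
      rw [e, shear_b_natAdd, ← yI_eq_natAdd, nilp_b_yI, smul_zero, add_zero]
  exact LinearMap.congr_fun h v

/-- **ONE AUTOMORPHISM, TWO CONSTRUCTIONS: `Φs λ = Ψ (shearEquiv λ)`** (gen 6's functorial `mapEquiv` of the shear = gen 13's `CliffordAlgebra.equivOfIsometry`
of the same shear; both send `ι v ↦ ι (shear v)`). -/
theorem Φs_eq_Ψ (lam : K) : (Φs K (n := n) lam : HT K (In n) ≃ₐ[K] HT K (In n)) = Ψ K (shearEquiv K n lam) := by
  have h : (Φs K (n := n) lam : HT K (In n) →ₐ[K] HT K (In n)) = (Ψ K (shearEquiv K n lam) : HT K (In n) →ₐ[K] HT K (In n)) := by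
    apply ExteriorAlgebra.hom_ext
    refine LinearMap.ext fun v => ?_
    show Φs K (n := n) lam (ExteriorAlgebra.ι K v) = Ψ K (shearEquiv K n lam) (ExteriorAlgebra.ι K v)
    rw [Φs_ι, Ψ_ι, shear_eq_shearEquiv]
  exact AlgEquiv.ext fun x => AlgHom.congr_fun h x

/-- so the two transports act identically on every class. -/
theorem Φs_apply_eq (lam : K) (x : HT K (In n)) : Φs K (n := n) lam x = Ψ K (shearEquiv K n lam) x := by
  rw [Φs_eq_Ψ]

/-- gen 13's frame vector is the image of `x_a` under gen 15's frame change: `u_a = Φs λ (X_a)` (`ℕ`-indexed). -/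
theorem uvec_eq_Φs_X (lam : K) (a : ℕ) : uvec K n lam a = Φs K (n := n) lam (X K n a) := by
  rw [Φs_apply_eq, Ψ_shear_X]

end Summit.Ventures.HSemireg.Wedge.HankelFrameChange
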